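import Literature.NumberTheory.EllipticCurves.FormalGroupQuasiPeriodAdditionIdentityProofs
import Literature.NumberTheory.EllipticCurves.FormalGroupLawAxiomsUniversalProofs
import Literature.NumberTheory.EllipticCurves.FormalGroupLogHomProofs
import HarnessLib

/-!
# Factor theorem along a curve `v = a(u)` in `R⟦u, v⟧` and the factorisations of `N = X(u)v² − X(v)u²`
# and `F = u +_F v` through `v − u`, `v − i(u)` (proofs only)

Topic `Literature/NumberTheory/EllipticCurves`. Pure proof file (no definition, no named fact), first of two
behind the INTEGRALITY of the addition cocycle `C₀ = η₀(u +_F v) − η₀(u) − η₀(v)` of the quasi-period function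
(`FormalGroupQuasiPeriod`; Katz 1981 §5.1: `η₀` is a quasi-logarithm, `∂η₀` integral). The pseudo-addition
theorem (`formalQuasiPeriodCocycle_mul_eq`) writes `M′·C₀ = N′` with `M′ = u·v·N·F`; integrality of `C₀` is
exact division by the factors of `M′` in `R⟦u, v⟧`, for which this file supplies:

* §1 `coeff_subst_X_zero'`, `X_one_dvd_of_subst_X_zero_eq_zero` (`G(u, 0) = 0 ⇒ v ∣ G`) and the **factor theorem
  along a curve** `X_one_sub_dvd_of_subst_eq_zero`: for `a ∈ uR⟦u⟧`, `P(u, a(u)) = 0 ⇒ (v − a(u)) ∣ P` (shift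
  `v ↦ v + a(u)`, divide by `v`, shift back);
* §2 the factorisations, over any commutative ring `R` (with `2` a non-zero-divisor and `R` a domain where marked):
  `N = (v − u)·N₁` (`chordN_eq_mul`), `N = (v − u)·(v − i(u))·U_N` with `U_N(0,0) = 1` (`chordN_eq_mul_mul`:
  the zero locus of `u²v²(x(u) − x(v))` is `v = u` ∪ `v = i(u)`, by `x(i(z)) = x(z)`,
  `formalXMulSq_subst_formalNeg_mul_X_sq`), and `F = (v − i(u))·U_F` with `U_F(0,0) = 1`
  (`formalGroupLaw_eq_mul`: `F(u, i(u)) = 0`, `formalGroupLaw_subst_X_formalNeg'`).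

BSD context: crux K★ `stmt-BirchSwinnertonDyer-22226`, hDR sector (iii) (`η`-period of the Weierstrass formal group:
the integral cocycle is what bounds `pⁿ·C₀(û, [k]û)` in `B_dR⁺/Fil^m`); BSD is not proved by any of this.

## References
* J. H. Silverman, *The Arithmetic of Elliptic Curves* (2009), III.2.3 (`x(−P) = x(P)`, `P + (−P) = O`), IV.1.
  [SilvermanAEC2009]
* N. M. Katz, *Crystalline cohomology, Dieudonné modules, and Jacobi sums* (1981), §5.1. [Katz1981CrystallineDieudonne]
-/

noncomputable section

open PowerSeries Literature.NumberTheory.EllipticCurves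

namespace WeierstrassCurve

/-! ### §1 Restriction to `v = 0`, to a curve `v = a(u)`, and the factor theorem -/

section Generic

variable {R : Type*} [CommRing R]

/-- The substitution `u ↦ X`, `v ↦ a` into `R⟦X⟧` is admissible for `a` without constant term.
[cite: SilvermanAEC2009, IV.1.1] -/
theorem hasSubst_X_powerSeries {a : R⟦X⟧} (ha : constantCoeff a = 0) :
    MvPowerSeries.HasSubst ![(PowerSeries.X : R⟦X⟧), a] :=
  MvPowerSeries.hasSubst_of_constantCoeff_zero fun i => by
    fin_cases i
    · exact PowerSeries.constantCoeff_X
    · exact ha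

/-- **Coefficients after setting `v = 0`**: `coeff n (G(T, 0)) = coeff_{(n, 0)} G`. [cite: SilvermanAEC2009, IV.1.1] -/
theorem coeff_subst_X_zero' (G : MvPowerSeries (Fin 2) R) (n : ℕ) :
    PowerSeries.coeff n (MvPowerSeries.subst ![(PowerSeries.X : R⟦X⟧), 0] G) =
      MvPowerSeries.coeff (Finsupp.single 0 n) G := by
  classical
  have hs : MvPowerSeries.HasSubst ![(PowerSeries.X : R⟦X⟧), 0] := hasSubst_X_powerSeries (map_zero _)
  rw [show PowerSeries.coeff (R := R) n = MvPowerSeries.coeff (Finsupp.single () n) from rfl,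
    MvPowerSeries.coeff_subst hs]
  have hprod : ∀ d : Fin 2 →₀ ℕ, (d.prod fun s m => ((![(PowerSeries.X : R⟦X⟧), 0]) s) ^ m) =
      (PowerSeries.X : R⟦X⟧) ^ d 0 * (0 : R⟦X⟧) ^ d 1 := fun d => finsupp_prod_pow_fin_two d _
  simp_rw [hprod]
  rw [finsum_eq_single _ (Finsupp.single 0 n)]
  · have e0 : (Finsupp.single (0 : Fin 2) n) 0 = n := by simp
    have e1 : (Finsupp.single (0 : Fin 2) n) 1 = 0 := by simp
    rw [e0, e1, pow_zero, mul_one,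
      show MvPowerSeries.coeff (Finsupp.single () n) (PowerSeries.X ^ n : R⟦X⟧) =
        PowerSeries.coeff n (PowerSeries.X ^ n : R⟦X⟧) from rfl,
      PowerSeries.coeff_X_pow_self, smul_eq_mul, mul_one]
  · intro d hd
    by_cases h1 : d 1 = 0
    · have h0 : d 0 ≠ n := fun h => hd (by
        ext i; fin_cases i
        · simpa using h
        · simpa using h1)
      rw [h1, pow_zero, mul_one,
        show MvPowerSeries.coeff (Finsupp.single () n) (PowerSeries.X ^ d 0 : R⟦X⟧) =
          PowerSeries.coeff n (PowerSeries.X ^ d 0 : R⟦X⟧) from rfl,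
        PowerSeries.coeff_X_pow, if_neg (Ne.symm h0), smul_zero]
    · rw [zero_pow h1, mul_zero, map_zero, smul_zero]

/-- `G(u, 0) = 0` makes `G` divisible by `v`. [cite: SilvermanAEC2009, IV.1.1] -/
theorem X_one_dvd_of_subst_X_zero_eq_zero {G : MvPowerSeries (Fin 2) R}
    (hG : MvPowerSeries.subst ![(PowerSeries.X : R⟦X⟧), 0] G = 0) :
    (MvPowerSeries.X 1 : MvPowerSeries (Fin 2) R) ∣ G := by
  rw [MvPowerSeries.X_dvd_iff]
  intro m hm
  have hm0 : m = Finsupp.single 0 (m 0) := by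
    ext i
    fin_cases i
    · simp
    · simpa using hm
  rw [hm0, ← coeff_subst_X_zero', hG, map_zero]

/-- **Factor theorem along a curve**: for `a ∈ uR⟦u⟧`, if `P(u, a(u)) = 0` in `R⟦u⟧` then `(v − a(u)) ∣ P` in
`R⟦u, v⟧` (shift `v ↦ v + a(u)`, which is an automorphism; the shifted series vanishes at `v = 0`, so is divisible
by `v`; shift back). [cite: SilvermanAEC2009, IV.1.1] -/
theorem X_one_sub_dvd_of_subst_eq_zero {a : R⟦X⟧} (ha : constantCoeff a = 0) {P : MvPowerSeries (Fin 2) R}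
    (hP : MvPowerSeries.subst ![(PowerSeries.X : R⟦X⟧), a] P = 0) :
    (MvPowerSeries.X 1 - a.subst (MvPowerSeries.X 0 : MvPowerSeries (Fin 2) R)) ∣ P := by
  set c : MvPowerSeries (Fin 2) R := a.subst (MvPowerSeries.X 0 : MvPowerSeries (Fin 2) R) with hc
  have hc0 : MvPowerSeries.constantCoeff c = 0 :=
    constantCoeff_powerSeries_subst_eq_zero (MvPowerSeries.constantCoeff_X 0) ha
  have hτ : MvPowerSeries.HasSubst ![(MvPowerSeries.X 0 : MvPowerSeries (Fin 2) R), MvPowerSeries.X 1 + c] :=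
    hasSubst_pair (MvPowerSeries.constantCoeff_X 0) (by rw [map_add, MvPowerSeries.constantCoeff_X, hc0, add_zero])
  have hτ' : MvPowerSeries.HasSubst ![(MvPowerSeries.X 0 : MvPowerSeries (Fin 2) R), MvPowerSeries.X 1 - c] :=
    hasSubst_pair (MvPowerSeries.constantCoeff_X 0) (by rw [map_sub, MvPowerSeries.constantCoeff_X, hc0, sub_zero])
  have hX0 : MvPowerSeries.HasSubst ![(PowerSeries.X : R⟦X⟧), 0] := hasSubst_X_powerSeries (map_zero _)
  have hXa : MvPowerSeries.HasSubst ![(PowerSeries.X : R⟦X⟧), a] := hasSubst_X_powerSeries ha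
  -- `c` under the three substitutions
  have hc_τ' : MvPowerSeries.subst ![(MvPowerSeries.X 0 : MvPowerSeries (Fin 2) R), MvPowerSeries.X 1 - c] c = c := by
    rw [hc, mvSubst_powerSeries_subst (PowerSeries.HasSubst.X 0) hτ', MvPowerSeries.subst_X hτ']; rfl
  have hc_0 : MvPowerSeries.subst ![(PowerSeries.X : R⟦X⟧), 0] c = a := by
    rw [hc, mvSubst_powerSeries_subst (PowerSeries.HasSubst.X 0) hX0, MvPowerSeries.subst_X hX0]
    exact PowerSeries.X_subst a
  -- the shifted series vanishes at `v = 0`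
  set Q := MvPowerSeries.subst ![(MvPowerSeries.X 0 : MvPowerSeries (Fin 2) R), MvPowerSeries.X 1 + c] P with hQ
  have hQ0 : MvPowerSeries.subst ![(PowerSeries.X : R⟦X⟧), 0] Q = 0 := by
    rw [hQ, MvPowerSeries.subst_comp_subst_apply hτ hX0]
    have hfam : (fun i => MvPowerSeries.subst ![(PowerSeries.X : R⟦X⟧), 0]
        ((![(MvPowerSeries.X 0 : MvPowerSeries (Fin 2) R), MvPowerSeries.X 1 + c]) i)) =
        ![(PowerSeries.X : R⟦X⟧), a] := by
      funext i
      fin_cases i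
      · exact MvPowerSeries.subst_X hX0 0
      · show MvPowerSeries.subst ![(PowerSeries.X : R⟦X⟧), 0] (MvPowerSeries.X 1 + c) = a
        rw [MvPowerSeries.subst_add hX0, MvPowerSeries.subst_X hX0, hc_0]
        exact zero_add a
    rw [hfam, hP]
  obtain ⟨Q', hQ'⟩ := X_one_dvd_of_subst_X_zero_eq_zero hQ0
  -- shift back
  have hback : MvPowerSeries.subst ![(MvPowerSeries.X 0 : MvPowerSeries (Fin 2) R), MvPowerSeries.X 1 - c] Q = P := by
    rw [hQ, MvPowerSeries.subst_comp_subst_apply hτ hτ']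
    have hfam : (fun i => MvPowerSeries.subst ![(MvPowerSeries.X 0 : MvPowerSeries (Fin 2) R), MvPowerSeries.X 1 - c]
        ((![(MvPowerSeries.X 0 : MvPowerSeries (Fin 2) R), MvPowerSeries.X 1 + c]) i)) =
        ![(MvPowerSeries.X 0 : MvPowerSeries (Fin 2) R), MvPowerSeries.X 1] := by
      funext i
      fin_cases i
      · exact MvPowerSeries.subst_X hτ' 0
      · show MvPowerSeries.subst _ (MvPowerSeries.X 1 + c) = MvPowerSeries.X 1
        rw [MvPowerSeries.subst_add hτ', MvPowerSeries.subst_X hτ', hc_τ']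
        show MvPowerSeries.X 1 - c + c = MvPowerSeries.X 1
        abel
    rw [hfam, subst_X_zero_X_one]
  refine ⟨MvPowerSeries.subst ![(MvPowerSeries.X 0 : MvPowerSeries (Fin 2) R), MvPowerSeries.X 1 - c] Q', ?_⟩
  rw [← hback, hQ', MvPowerSeries.subst_mul hτ', MvPowerSeries.subst_X hτ']
  rfl

end Generic

/-! ### §2 The factorisations of `N = X(u)v² − X(v)u²` and of `F` -/

section Factors

variable {R : Type*} [CommRing R] (W : WeierstrassCurve R)

/-- `N(u, u) = 0`, hence **`N = (v − u)·N₁`**. [cite: SilvermanAEC2009, III.2.3] -/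
theorem chordN_eq_mul :
    ∃ N₁ : MvPowerSeries (Fin 2) R,
      W.formalXMulSq.subst (MvPowerSeries.X 0 : MvPowerSeries (Fin 2) R) * MvPowerSeries.X 1 ^ 2 -
          W.formalXMulSq.subst (MvPowerSeries.X 1 : MvPowerSeries (Fin 2) R) * MvPowerSeries.X 0 ^ 2 =
        (MvPowerSeries.X 1 - MvPowerSeries.X 0) * N₁ := by
  have hXa : MvPowerSeries.HasSubst ![(PowerSeries.X : R⟦X⟧), PowerSeries.X] :=
    hasSubst_X_powerSeries PowerSeries.constantCoeff_X
  have h0 : MvPowerSeries.subst ![(PowerSeries.X : R⟦X⟧), PowerSeries.X]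
      (W.formalXMulSq.subst (MvPowerSeries.X 0 : MvPowerSeries (Fin 2) R) * MvPowerSeries.X 1 ^ 2 -
        W.formalXMulSq.subst (MvPowerSeries.X 1 : MvPowerSeries (Fin 2) R) * MvPowerSeries.X 0 ^ 2) = 0 := by
    rw [MvPowerSeries.subst_sub hXa, MvPowerSeries.subst_mul hXa, MvPowerSeries.subst_mul hXa,
      MvPowerSeries.subst_pow hXa, MvPowerSeries.subst_pow hXa, MvPowerSeries.subst_X hXa, MvPowerSeries.subst_X hXa,
      mvSubst_powerSeries_subst (PowerSeries.HasSubst.X 0) hXa, mvSubst_powerSeries_subst (PowerSeries.HasSubst.X 1) hXa,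
      MvPowerSeries.subst_X hXa, MvPowerSeries.subst_X hXa]
    show W.formalXMulSq.subst (PowerSeries.X : R⟦X⟧) * PowerSeries.X ^ 2 -
      W.formalXMulSq.subst (PowerSeries.X : R⟦X⟧) * PowerSeries.X ^ 2 = 0
    exact sub_self _
  obtain ⟨N₁, hN₁⟩ := X_one_sub_dvd_of_subst_eq_zero PowerSeries.constantCoeff_X h0
  refine ⟨N₁, ?_⟩
  rw [hN₁, PowerSeries.subst_X (PowerSeries.HasSubst.X 0)]

/-- `N(u, i(u)) = 0` (`x(i(z)) = x(z)`). [cite: SilvermanAEC2009, III.2.3] -/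
theorem subst_X_formalNeg_chordN :
    MvPowerSeries.subst ![(PowerSeries.X : R⟦X⟧), W.formalNeg]
      (W.formalXMulSq.subst (MvPowerSeries.X 0 : MvPowerSeries (Fin 2) R) * MvPowerSeries.X 1 ^ 2 -
        W.formalXMulSq.subst (MvPowerSeries.X 1 : MvPowerSeries (Fin 2) R) * MvPowerSeries.X 0 ^ 2) = 0 := by
  have hXa : MvPowerSeries.HasSubst ![(PowerSeries.X : R⟦X⟧), W.formalNeg] :=
    hasSubst_X_powerSeries W.constantCoeff_formalNeg
  rw [MvPowerSeries.subst_sub hXa, MvPowerSeries.subst_mul hXa, MvPowerSeries.subst_mul hXa,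
    MvPowerSeries.subst_pow hXa, MvPowerSeries.subst_pow hXa, MvPowerSeries.subst_X hXa, MvPowerSeries.subst_X hXa,
    mvSubst_powerSeries_subst (PowerSeries.HasSubst.X 0) hXa, mvSubst_powerSeries_subst (PowerSeries.HasSubst.X 1) hXa,
    MvPowerSeries.subst_X hXa, MvPowerSeries.subst_X hXa]
  show W.formalXMulSq.subst (PowerSeries.X : R⟦X⟧) * W.formalNeg ^ 2 -
    W.formalXMulSq.subst W.formalNeg * PowerSeries.X ^ 2 = 0
  rw [PowerSeries.X_subst, W.formalXMulSq_subst_formalNeg_mul_X_sq, sub_self]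

/-- `F(u, i(u)) = 0`, hence **`F = (v − i(u))·U_F`** with `U_F(0, 0) = 1`. [cite: SilvermanAEC2009, IV.1.1] -/
theorem formalGroupLaw_eq_mul :
    ∃ U : MvPowerSeries (Fin 2) R,
      W.formalGroupLaw = (MvPowerSeries.X 1 - W.formalNeg.subst (MvPowerSeries.X 0 : MvPowerSeries (Fin 2) R)) * U ∧
        MvPowerSeries.constantCoeff U = 1 := by
  obtain ⟨U, hU⟩ := X_one_sub_dvd_of_subst_eq_zero W.constantCoeff_formalNeg W.formalGroupLaw_subst_X_formalNeg'
  refine ⟨U, hU, ?_⟩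
  -- restrict to `u = 0`: `F(0, v) = v = (v − 0)·U(0, v)`
  have hs := hasSubst_zero_X (R := R)
  have h := congrArg (MvPowerSeries.subst ![(0 : R⟦X⟧), PowerSeries.X]) hU
  rw [W.formalGroupLaw_subst_zero_X, MvPowerSeries.subst_mul hs, MvPowerSeries.subst_sub hs, subst_zero_X_X_one,
    subst_zero_X_powerSeries_subst_X_zero, W.constantCoeff_formalNeg, map_zero, sub_zero] at h
  -- `X = X·U(0,X)` forces `U(0, X) = 1`, whose constant term is that of `U`
  have h1 : MvPowerSeries.subst ![(0 : R⟦X⟧), PowerSeries.X] U = 1 := by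
    have h2 : PowerSeries.X * (MvPowerSeries.subst ![(0 : R⟦X⟧), PowerSeries.X] U - 1) = 0 := by
      rw [mul_sub, mul_one, ← h, sub_self]
    have h3 := PowerSeries.X_mul_cancel (by simpa using h2 : PowerSeries.X * (MvPowerSeries.subst ![(0 : R⟦X⟧),
      PowerSeries.X] U - 1) = PowerSeries.X * 0)
    exact sub_eq_zero.mp h3
  have h4 := congrArg (PowerSeries.coeff 0) h1
  rw [coeff_subst_zero_X, PowerSeries.coeff_zero_eq_constantCoeff, map_one] at h4
  simpa using h4

variable [IsDomain R]

/-- **`N = (v − u)·(v − i(u))·U_N` with `U_N(0,0) = 1`** when `2 ≠ 0` in the domain `R`: the zero locus of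
`N = u²v²(x(u) − x(v))` is `{v = u} ∪ {v = i(u)}` (`x(i(z)) = x(z)`), both simple. [cite: SilvermanAEC2009, III.2.3] -/
theorem chordN_eq_mul_mul (h2 : (2 : R) ≠ 0) :
    ∃ U : MvPowerSeries (Fin 2) R,
      W.formalXMulSq.subst (MvPowerSeries.X 0 : MvPowerSeries (Fin 2) R) * MvPowerSeries.X 1 ^ 2 -
          W.formalXMulSq.subst (MvPowerSeries.X 1 : MvPowerSeries (Fin 2) R) * MvPowerSeries.X 0 ^ 2 =
        (MvPowerSeries.X 1 - MvPowerSeries.X 0) *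
          ((MvPowerSeries.X 1 - W.formalNeg.subst (MvPowerSeries.X 0 : MvPowerSeries (Fin 2) R)) * U) ∧
        MvPowerSeries.constantCoeff U = 1 := by
  obtain ⟨N₁, hN₁⟩ := W.chordN_eq_mul
  -- `N₁(u, i(u)) = 0`: `N(u, i(u)) = 0 = (i(u) − u)·N₁(u, i(u))` and `i(u) − u = −2u + ⋯ ≠ 0`
  have hXa : MvPowerSeries.HasSubst ![(PowerSeries.X : R⟦X⟧), W.formalNeg] :=
    hasSubst_X_powerSeries W.constantCoeff_formalNeg
  have hz := W.subst_X_formalNeg_chordN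
  rw [hN₁, MvPowerSeries.subst_mul hXa, MvPowerSeries.subst_sub hXa, MvPowerSeries.subst_X hXa,
    MvPowerSeries.subst_X hXa] at hz
  have hne : ((![(PowerSeries.X : R⟦X⟧), W.formalNeg]) 1 - (![(PowerSeries.X : R⟦X⟧), W.formalNeg]) 0) ≠ 0 := by
    show W.formalNeg - PowerSeries.X ≠ 0
    intro h
    have h1 := congrArg (PowerSeries.coeff 1) h
    rw [map_sub, W.coeff_one_formalNeg, PowerSeries.coeff_one_X, map_zero] at h1
    exact h2 (by linear_combination -h1)
  have hN₁0 : MvPowerSeries.subst ![(PowerSeries.X : R⟦X⟧), W.formalNeg] N₁ = 0 :=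
    (mul_eq_zero.mp hz).resolve_left hne
  obtain ⟨U, hU⟩ := X_one_sub_dvd_of_subst_eq_zero W.constantCoeff_formalNeg hN₁0
  refine ⟨U, by rw [hN₁, hU], ?_⟩
  -- `u = 0`: `N(0, v) = v² = (v − 0)(v − 0)·U(0, v)`
  have hs := hasSubst_zero_X (R := R)
  have h := congrArg (MvPowerSeries.subst ![(0 : R⟦X⟧), PowerSeries.X]) hN₁
  rw [hU, MvPowerSeries.subst_sub hs, MvPowerSeries.subst_mul hs, MvPowerSeries.subst_mul hs,
    MvPowerSeries.subst_pow hs, MvPowerSeries.subst_pow hs, MvPowerSeries.subst_mul hs, MvPowerSeries.subst_mul hs,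
    MvPowerSeries.subst_sub hs, MvPowerSeries.subst_sub hs, subst_zero_X_X_zero, subst_zero_X_X_one,
    subst_zero_X_powerSeries_subst_X_zero, subst_zero_X_powerSeries_subst_X_zero,
    subst_zero_X_powerSeries_subst_X_one, W.constantCoeff_formalXMulSq, W.constantCoeff_formalNeg, map_one, map_zero,
    sub_zero, one_mul, zero_pow two_ne_zero, mul_zero, sub_zero] at h
  -- `X² = X·(X·U(0,X))`
  have h1 : MvPowerSeries.subst ![(0 : R⟦X⟧), PowerSeries.X] U = 1 := by
    have h2' : PowerSeries.X ^ 2 * (MvPowerSeries.subst ![(0 : R⟦X⟧), PowerSeries.X] U - 1) = 0 := by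
      linear_combination -h
    exact sub_eq_zero.mp ((mul_eq_zero.mp h2').resolve_left (pow_ne_zero 2 PowerSeries.X_ne_zero))
  have h4 := congrArg (PowerSeries.coeff 0) h1
  rw [coeff_subst_zero_X, PowerSeries.coeff_zero_eq_constantCoeff, map_one] at h4
  simpa using h4

end Factors

end WeierstrassCurve
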